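import Summits.ResolutionOfSingularities.ResolutionOfSingularities.Theorems.LossEntryW07
import HarnessLib

/-!
# LossEntryW08 — walk plumbing of the loss→entry law `LawLossEntry`, part 8/11

decomp-res-lens-3, gen 29 (HOME/decomp-res-lens-3/g29/NODE-g29.md).  TOOL at 0 toward the residual item
stmt-ResolutionOfSingularities-27367 (`WallCut.NoLossyStrictTailsDeep` ⟸ `LossEpisode.LawLossEntry`).  Imports part 7 (`Theorems.LossEntryW07`, to be landed first).

Contents: §13 `pencil_of_loss_a`, LAW `lawLossEntryAt_of_loss_a1` ((a)-loss + repeat in the chart `j`).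
-/

open MvPolynomial Finset
open Literature.AlgebraicGeometry.Resolution
open Literature.AlgebraicGeometry.Resolution.Hauser2010
open Literature.AlgebraicGeometry.Resolution.PointBlowup
open Summit.ResolutionOfSingularities.ResolutionOfSingularities.Theorems.TightDefectClasses
open Summit.ResolutionOfSingularities.ResolutionOfSingularities.Theorems.TightDefectStrongWalks
open Summit.ResolutionOfSingularities.ResolutionOfSingularities.Theorems.ItineraryCutClasses
open Summit.ResolutionOfSingularities.ResolutionOfSingularities.Theorems.BoundaryLedger
open Summit.ResolutionOfSingularities.ResolutionOfSingularities.Theorems.ProximityCut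
open Summit.ResolutionOfSingularities.ResolutionOfSingularities.Theorems.LossIsFatalLayer (chartMap chartMap_X chartMap_X_self
  chartMap_X_ne chartMap_C)
open Summit.ResolutionOfSingularities.ResolutionOfSingularities.Theorems.LossExitCone
open Summit.ResolutionOfSingularities.ResolutionOfSingularities.Theorems.LossPolygon

/-! ## §13 The walk after an (a)-loss (chart of the run letter `i`, `b_t(j) ≠ 0`) followed by a repeat in the chart `j` -/

namespace Summit.ResolutionOfSingularities.ResolutionOfSingularities.Theorems.LossEpisode

open Summit.ResolutionOfSingularities.ResolutionOfSingularities.Theorems.LossPolygon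

variable {K : Type} [Field K] [DecidableEq K] {q : ℕ} {s₀ : State (Fin 3) K}

section WalkA

variable {W : ForcedWalk q s₀} {N s : ℕ}

/-- **THE (a)-PENCIL (PROVED):** at an (a)-loss (`j_t = i`, `b_t(j) ≠ 0`) from a run state the translation satisfies
`b_t(l) = λ · b_t(j)` with `λ` the pencil parameter of the run state. [NODE-g28 F19 (a); new] -/
theorem pencil_of_loss_a (hroot : IsRoot q s₀) (hT : TailHyp W N s) {t : ℕ} (hNt : N ≤ t) {i j l : Fin 3} {k m : ℕ}
    (hS : IsRunState W s t i j l k m) (hjt : W.j t = i) (hbj : W.b t j ≠ 0) :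
    ∃ φ₀ lam : K, φ₀ ≠ 0 ∧ W.b t l = lam * W.b t j ∧ ∀ E : Fin 3 →₀ ℕ, E.degree = s →
      coeff ((W.st t).r + E) (W.st t).F = φ₀ * coeff E ((X l - C lam * X j) ^ s) := by
  have hij : i ≠ j := hS.1
  have hli : l ≠ i := hS.2.1
  obtain ⟨φ₀, lam, hφ₀, hpen, hcase⟩ := runState_pencil hroot hT hNt hS (fun h => hbj (by rw [h.2]; rfl))
  rcases hcase with ⟨hj, -⟩ | ⟨hl, -⟩ | ⟨-, -, hbl⟩
  · exact absurd (hjt.symm.trans hj) hij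
  · exact absurd (hjt.symm.trans hl).symm hli
  · exact ⟨φ₀, lam, hφ₀, hbl, hpen⟩

/-- **LAW (L_E), CASE (a1) (PROVED): LOSS IN THE CHART OF THE RUN LETTER + REPEAT IN THE CHART `j` ⇒ STRICTLY SMALLER `β`.**
From a heavy run state `(i,j,l;k,m)` on the tail, an (a)-loss at `t` (`j_t = i`, `b_t(j) = β ≠ 0`, `b_t(l) = λβ`) followed by a
proximity repeat in the chart `j` lands at `t + 2` in the run state `(j, i, l ; d, T)` with `β_{t+2} < β_t`.  The one-wall state
at `t + 1` is TWISTED (its initial form is `u_i^T (u_l − λ u_j)^s ⋯`); the repeat is FORCED to translate by `b_{t+1}(l) = λ`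
(`coeff_shears_a_apex`), which untwists: `F_{t+2} = clean chart_j σ_{l,j,λ} F_{t+1} = clean chart_j clean chart_i G^prep`
(twist commutation) with `G^prep = σ_{l,j,λ} σ_{j,i,β} σ_{l,i,λβ} F_t = swapShear_{i,j,1/β,β} G_b`, `G_b = σ_{i,j,1/β} σ_{l,j,λ} F_t`
the (b)-type preparation; so `β_{t+2} = α + β − 1` of the entry set of `clean G^prep` (section `j`, ceiling `l`), whose vertex is
that of the entry set of `clean G_b` (section `i`, ceiling `l`) by the two swap dominations, and T8b for `G_b` (axis witness
transported from F-isolation at `t + 2`) concludes. [CJS2020 Lemma 13.4 for the walk's (a)-presentation; new] -/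
theorem lawLossEntryAt_of_loss_a1 (hroot : IsRoot q s₀) (hT : TailHyp W N s)
    (hLucas : ∀ D T : ℕ, q ∣ D → ¬ q ∣ T → ((D.choose T : ℕ) : K) = 0) {t : ℕ} (hNt : N ≤ t) {i j l : Fin 3}
    {k m : ℕ} (hS : IsRunState W s t i j l k m) (hm : q ≤ m + s) (hjt : W.j t = i) (hbj : W.b t j ≠ 0)
    (hloss : IsLossMove W t) (hst : StaysOnNewest W t) (hj1 : W.j (t + 1) = j) :
    ∃ u : ℕ, t < u ∧ ∃ (i' j' l' : Fin 3) (k' m' : ℕ), IsRunState W s u i' j' l' k' m' ∧ q ≤ m' + s ∧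
      runBeta W s u i' j' l' < runBeta W s t i j l := by
  classical
  obtain ⟨hord, hq, hks, hms, -⟩ := runState_ledger hroot hT hNt hS
  obtain ⟨hri, hrj, hrl⟩ := hS.r_apply
  have hij : i ≠ j := hS.1
  have hli : l ≠ i := hS.2.1
  have hlj : l ≠ j := hS.2.2.1
  have hsq : s < q := hT.s_lt
  have h1s : 1 ≤ s := hT.one_le
  obtain ⟨φ₀, lam, hφ₀, hbl, hpen⟩ := pencil_of_loss_a hroot hT hNt hS hjt hbj
  have hro : (W.st t).r.degree + s = k + m + s := by
    rw [hS.2.2.2.2.2.1, map_add, Finsupp.degree_single, Finsupp.degree_single]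
  obtain ⟨T, hoT, h1T, hr1, hqT, hnext⟩ := lossMove_next hroot hT hNt hloss
  have hTo : q + T = k + m + s := by
    have h := hord.symm.trans hoT
    have h' : s + k + m = q + T := by exact_mod_cast h
    omega
  rcases hnext with ⟨hnst, -, -⟩ | ⟨-, l₂, d, hl₂i, hl₂j, hTd, h1d, hS2⟩
  · exact absurd hst hnst
  rw [hj1] at hS2 hl₂i
  rw [hjt] at hS2 hl₂j hr1
  have hl₂ : l₂ = l := by
    rcases fin3_eq_or i j l l₂ hij hli.symm (Ne.symm hlj) with h | h | h
    · exact absurd h hl₂j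
    · exact absurd h hl₂i
    · exact h
  rw [hl₂] at hS2
  have hS2' : IsRunState W s (t + 1 + 1) j i l d T := hS2
  refine ⟨t + 1 + 1, by omega, j, i, l, d, T, hS2', hqT.le, ?_⟩
  have hbi1 : W.b (t + 1) i = 0 := by have := hst.2; rwa [hjt] at this
  -- the equations `G_a`, `G^prep`, `G_b`
  have hF1 : (W.st (t + 1)).F =
      deletePthPowers q (chartTransform q i (shear j i (W.b t j) (shear l i (lam * W.b t j) (W.st t).F))) := by
    rw [st_succ_F_two_shears hroot W t hij.symm hli hlj.symm hjt, hbl]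
  set Ga : MvPolynomial (Fin 3) K := shear j i (W.b t j) (shear l i (lam * W.b t j) (W.st t).F) with hGa
  set Gp : MvPolynomial (Fin 3) K := shear l j lam Ga with hGp
  set φ : K := (W.b t j)⁻¹ with hφdef
  have hφβ : φ * W.b t j = 1 := inv_mul_cancel₀ hbj
  have hφ : φ ≠ 0 := inv_ne_zero hbj
  set Gb : MvPolynomial (Fin 3) K := shear i j φ (shear l j lam (W.st t).F) with hGb
  have hSw : Gp = swapShear i j φ (W.b t j) Gb := shears_a_eq_swapShear hij hli.symm hlj.symm hφβ lam _
  have hSw' : swapShear j i (W.b t j) φ Gp = Gb := by rw [hSw, swapShear_swapShear hli hlj hij hφβ]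
  have hF2 : (W.st (t + 1 + 1)).F = deletePthPowers q (chartTransform q j (shear l j (W.b (t + 1) l) (W.st (t + 1)).F)) := by
    rw [st_succ_F_two_shears hroot W (t + 1) hij hlj hli.symm hj1, hbi1, shear_zero]
  -- degrees
  have hdegF : ∀ D ∈ (W.st t).F.support, k + m + s ≤ D.degree := fun D hD =>
    le_degree_of_mem_support_runState hroot hT hNt hS hD
  have hoGa : ∀ E ∈ Ga.support, k + m + s ≤ E.degree := fun E hE =>
    le_degree_of_mem_support_shear hli.symm hij hlj (W.b t j)
      (fun E' hE' => le_degree_of_mem_support_shear hij hli.symm hlj.symm (lam * W.b t j) hdegF hE') hE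
  have hqGa : ∀ E ∈ Ga.support, q ≤ E.degree := fun E hE => by have := hoGa E hE; omega
  have hoGp : ∀ E ∈ Gp.support, k + m + s ≤ E.degree := fun E hE =>
    le_degree_of_mem_support_shear hij.symm hlj.symm hli.symm lam hoGa hE
  have hqGp : ∀ E ∈ Gp.support, q ≤ E.degree := fun E hE => by have := hoGp E hE; omega
  have hqF1 : ∀ D ∈ (W.st (t + 1)).F.support, q ≤ D.degree := fun D hD => le_degree_of_mem_support hroot W (t + 1) hD
  have hqF1σ : ∀ g : K, ∀ D ∈ (shear l j g (W.st (t + 1)).F).support, q ≤ D.degree := fun g D hD =>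
    le_degree_of_mem_support_shear hij.symm hlj.symm hli.symm g hqF1 hD
  have hqGaσ : ∀ g : K, ∀ E ∈ (shear l j g Ga).support, q ≤ E.degree := fun g E hE =>
    le_degree_of_mem_support_shear hij.symm hlj.symm hli.symm g hqGa hE
  have hoGb : ∀ D ∈ (deletePthPowers q Gb).support, k + m + s ≤ D.degree := fun D hD => by
    rw [support_deletePthPowers'] at hD
    exact le_degree_of_mem_support_prepared hroot hT hNt hS _ _ (Finset.mem_filter.mp hD).1
  have hoGp' : ∀ E ∈ (deletePthPowers q Gp).support, k + m + s ≤ E.degree := fun E hE => by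
    rw [support_deletePthPowers'] at hE
    exact hoGp E (Finset.mem_filter.mp hE).1
  -- FORCING: the repeat translates by `b_{t+1}(l) = λ`
  have hord2 : ordZero (W.st (t + 1 + 1)).F = ((s + d + T : ℕ) : ℕ∞) := (runState_ledger hroot hT (by omega) hS2').1
  set A : Fin 3 →₀ ℕ := Finsupp.single i T + Finsupp.single j s with hA
  have hAi : A i = T := by simp [hA, hij]
  have hAj : A j = s := by simp [hA, Ne.symm hij]
  have hAl : A l = 0 := by simp [hA, Ne.symm hli, Ne.symm hlj]
  have hAdeg : A.degree = T + s := by rw [hA, map_add, Finsupp.degree_single, Finsupp.degree_single]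
  have hqA : q ≤ A.degree := by rw [hAdeg]; omega
  have hPA : ¬ IsPthPowerExponent q A := by
    rw [isPthPowerExponent_iff_of_fin3 hij hli.symm hlj.symm, hAj]
    intro h
    exact absurd (Nat.le_of_dvd (by omega) h.2.1) (by omega)
  set B : Fin 3 →₀ ℕ := Finsupp.single i ((W.st t).r i + (W.st t).r j) + Finsupp.single j s with hB
  have hBdeg : B.degree = k + m + s := by rw [hB, map_add, Finsupp.degree_single, Finsupp.degree_single, hri, hrj]
  have hqB : q ≤ B.degree := by rw [hBdeg]; omega
  have hcEB : chartExponent q i B = A := by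
    ext w
    rcases fin3_eq_or i j l w hij hli.symm (Ne.symm hlj) with h | h | h <;> rw [h]
    · rw [chartExponent_apply, if_pos rfl, hBdeg, hAi]; omega
    · rw [chartExponent_apply, if_neg (Ne.symm hij), hAj, hB, Finsupp.add_apply, Finsupp.single_apply, if_neg hij,
        Finsupp.single_eq_same, zero_add]
    · rw [chartExponent_apply, if_neg hli, hAl, hB, Finsupp.add_apply, Finsupp.single_apply, if_neg (Ne.symm hli),
        Finsupp.single_apply, if_neg (Ne.symm hlj), add_zero]
  have hμ : W.b (t + 1) l = lam := by
    set μ : K := W.b (t + 1) l with hμdef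
    -- the coefficient of `chart_j A` in `F_{t+2}` vanishes (degree `T + d < ord F_{t+2}`) …
    have hvan : coeff (chartExponent q j A) (W.st (t + 1 + 1)).F = 0 := by
      refine coeff_eq_zero_of_degree_lt_ordZero ?_
      have hdeg : (chartExponent q j A).degree = T + d := by
        rw [degree_fin3 hij hli.symm hlj.symm, chartExponent_apply, if_neg hij, chartExponent_apply, if_pos rfl,
          chartExponent_apply, if_neg hlj, hAi, hAl, hAdeg]
        omega
      rw [hord2, hdeg]
      exact_mod_cast (by omega : T + d < s + d + T)
    -- … and equals `φ₀ β^m (μ − λ)^s`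
    have h1 : coeff (chartExponent q j A) (W.st (t + 1 + 1)).F = coeff A (shear l j μ (W.st (t + 1)).F) := by
      rw [coeff_succ_two_shears hroot W (t + 1) hij hlj hli.symm hj1 hqA hPA, hbi1, shear_zero]
    have h2 : coeff A (shear l j μ (W.st (t + 1)).F) = coeff B (shear l j μ Ga) := by
      have h : coeff A (deletePthPowers q (shear l j μ (W.st (t + 1)).F)) = coeff A (shear l j μ (W.st (t + 1)).F) := by
        rw [coeff_deletePthPowers, if_neg hPA]
      rw [← h, hF1, deletePthPowers_shear_deletePthPowers_chartTransform hij.symm hlj.symm hli.symm hLucas μ hqGa,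
        coeff_deletePthPowers, if_neg hPA, ← hcEB, coeff_chartTransform_chartExponent_of_le (hqGaσ μ) hqB]
    have hsplit : shear l j μ Ga = shear l j (μ - lam) Gp := by
      have hμ' : lam + (μ - lam) = μ := by ring
      rw [hGp, shear_shear_same hlj, hμ']
    have h3 : coeff B (shear l j μ Ga) = φ₀ * W.b t j ^ ((W.st t).r j) * (μ - lam) ^ s := by
      rw [hsplit, hGp, hGa]
      exact coeff_shears_a_apex hij hli.symm hlj.symm hrl hro φ₀ lam (W.b t j) (μ - lam) (walk_r hroot W t) hpen
    have h0 : φ₀ * W.b t j ^ ((W.st t).r j) * (μ - lam) ^ s = 0 := by rw [← h3, ← h2, ← h1, hvan]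
    rcases mul_eq_zero.mp h0 with h | h
    · rcases mul_eq_zero.mp h with h' | h'
      · exact absurd h' hφ₀
      · exact absurd (pow_eq_zero_iff (by rw [hrj]; omega) |>.mp h') hbj
    · exact sub_eq_zero.mp (pow_eq_zero_iff (by omega) |>.mp h)
  rw [hμ] at hF2
  -- the polygon identity `Δ(F_{t+2}) = Ψ₍₀:₁₎ EP(clean G^prep ; j, l)`
  obtain ⟨hr₂j, hr₂i, hr₂l⟩ := hS2'.r_apply
  have hr₁i : (W.st (t + 1)).r i = T := by rw [hr1, Finsupp.single_eq_same]
  have hr₁j : (W.st (t + 1)).r j = 0 := by rw [hr1, Finsupp.single_apply, if_neg hij]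
  have hr₁l : (W.st (t + 1)).r l = 0 := by rw [hr1, Finsupp.single_apply, if_neg (Ne.symm hli)]
  have hcleanS : deletePthPowers q (shear l j lam (W.st (t + 1)).F) = deletePthPowers q (chartTransform q i Gp) := by
    rw [hF1, deletePthPowers_shear_deletePthPowers_chartTransform hij.symm hlj.symm hli.symm hLucas lam hqGa]
  have hP2 : polyPts s (W.st (t + 1 + 1)).r i j l (W.st (t + 1 + 1)).F =
      (entryPts s (k + m + s) j l (deletePthPowers q Gp)).image psi01 := by
    rw [hF2, polyPts_clean_chart_snd hij hli.symm hlj.symm (r := (W.st (t + 1)).r) (by rw [hr₂i, hr₁i])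
      (by rw [hr₂j, hr₁i, hr₁j]; omega) hr₁l hr₂l (hqF1σ lam), hcleanS,
      polyPts_clean_chart_eq_entryPts hij hli.symm hr₁i hr₁j hr₁l hTo hqGp]
  -- the axis witness: F-isolation at `t + 2` for the pair `(i, l)`, transported to `clean G_b`
  obtain ⟨M, hM, hMil⟩ := ConeCutAxisLaw.axis_law W (t + 1 + 1) i l hli.symm
  rw [hF2, support_deletePthPowers_chartTransform j _ (hqF1σ lam), Finset.mem_image] at hM
  obtain ⟨D', hD', rfl⟩ := hM
  rw [chartExponent_apply, if_neg hij, chartExponent_apply, if_neg hlj] at hMil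
  have hD'c : D' ∈ (deletePthPowers q (chartTransform q i Gp)).support := by
    rw [← hcleanS, support_deletePthPowers']; exact hD'
  rw [support_deletePthPowers_chartTransform i Gp hqGp, Finset.mem_image] at hD'c
  obtain ⟨E', hE', rfl⟩ := hD'c
  have hE'c : E' ∈ (deletePthPowers q Gp).support := by rw [support_deletePthPowers']; exact hE'
  have hoE' : k + m + s ≤ E'.degree := hoGp' E' hE'c
  rw [chartExponent_apply, if_pos rfl, chartExponent_apply, if_neg hli] at hMil
  obtain ⟨R, hR, hRl, hRdeg, -⟩ := exists_dom_swapShear hlj hli hij.symm hbj hφ hLucas Gp hE'c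
  rw [hSw'] at hR
  have hax : R.degree + R l < 2 * q := by rw [hRdeg, hRl]; omega
  have hRl' : R l < s := by rw [hRl]; omega
  have hneEPb : (entryPts s (k + m + s) i l (deletePthPowers q Gb)).Nonempty := ⟨_, entryPt_mem_entryPts _ _ _ _ _ hR hRl'⟩
  -- vertex transport `EP(clean G_b ; i, l) = EP(clean G^prep ; j, l)` (the two swap dominations)
  have h21 := vertexOf_entryPts_eq_of_dom (s := s) (o := k + m + s) (a := i) (c := l) (a' := j) (c' := l)
    (G := deletePthPowers q Gb) (G' := deletePthPowers q Gp)
    (fun E hE hEl => by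
      obtain ⟨E', hE', hE'l, hE'deg, hE'j⟩ := exists_dom_swapShear hli hlj hij hφ hbj hLucas Gb hE
      rw [← hSw] at hE'
      exact ⟨E', hE', by omega, toLex_entryPt_le hE'deg (hoGb E hE) hE'j hE'l.le hEl⟩)
    (fun E' hE' hE'l => by
      obtain ⟨E, hE, hEl, hEdeg, hEi⟩ := exists_dom_swapShear hlj hli hij.symm hbj hφ hLucas Gp hE'
      rw [hSw'] at hE
      exact ⟨E, hE, by omega, toLex_entryPt_le hEdeg (hoGp' E' hE') hEi hEl.le hE'l⟩)
    hneEPb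
  -- the entry law T8b for `G_b`
  have hqj : q ≤ s + (W.st t).r j := by rw [hrj]; omega
  have h8 := entry_lt_betaOf_of_axisWitness hij hli.symm (Ne.symm hlj) hrl hφ lam
    (fun D hD => not_isPthPowerExponent_of_mem_support hroot W t hD) (walk_r hroot W t)
    (fun D hD => by rw [hri, hrj]; exact le_degree_of_mem_support_runState hroot hT hNt hS hD)
    (polyPts_nonempty_of_heavy_fst hroot W t (Ne.symm hlj) i hqj hrl)
    (alphaOf_polyPts_lt_one hroot W t (Ne.symm hlj) i hqj hrl) hsq (by rw [hri, hrj]; omega) (by rw [hri, hrj]; omega)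
    hR hax
  rw [hri, hrj] at h8
  unfold runBeta
  rw [hP2, betaOf_image_psi01 h21.1]
  unfold alphaOf betaOf at h8 ⊢
  rw [← h21.2]
  exact h8

end WalkA

end Summit.ResolutionOfSingularities.ResolutionOfSingularities.Theorems.LossEpisode
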